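import Literature.Computability.Complexity.StackArith
import Literature.Computability.Complexity.TM2ToStackProgram
import HarnessLib

/-!
# A linear-time interpreter loop for a fixed flat program, with running extreme heights (PPST 1983, §3)

Literature / complexity toolkit, fourteenth brick of the inline formalization of
Paul–Pippenger–Szemerédi–Trotter 1983 (`PaulPippengerSzemerediTrotter1983.lean`, fact
`PaulEtAl1983_NTIME_not_subset_DTIME`; roadmap Layer 4, machines, part 1). The local check (C1)
of the four-alternation protocol (`…Claims.lean`, `CondSim`) re-simulates one time block: `b`
steps of the simulated machine from a claimed (label, contents-above-the-cut), and compares the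
outcome — final control, final contents, and the EXTREME heights met — with the claims. The
simulated machine will be a flat binary stack program `P : AProg Bool (Fin K)`
(`SymbolPrograms.lean`; every `TM2` decider has one with linear overhead,
`TM2ToStackProgram.lean`). This file builds, for a fixed `P`, a structured binary stack program
(`Com`, `StackPrograms.lean`) interpreting `P` step by step on its own registers while keeping,
per simulated register, the running minimal and maximal height in unary at `O(1)` cost per step
(a flat step changes one height by `±1`: keep `d = h − min`, `min`, `u = max − h`, `max`), driven
by a unary fuel register:

* `IReg K` — registers: simulated `r k`, statistics `dn k`, `mn k`, `up k`, `mx k`, the unary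
  program counter `pc`, the fuel; `PPSTInterp.ISt` / `ISt.store` — register files;
* `incH`, `decH` (height bookkeeping), `units`, `exec P i` (instruction `i`), `decode`,
  `stepBody P` (decode the unary counter, execute, write the new counter), `simLoop P`;
* `runs_stepBody` — one simulated step costs `≤ 3|P| + 9`; **`runs_simLoop`** — `f` units of
  fuel simulate `P.step^[f]` and leave the running extreme heights (`statMin`, `statMax`),
  within `f (3|P| + 11) + 1` steps; `statMin_le`/`exists_statMin_eq`/… — the statistics are the
  extreme heights over the simulated steps.

No named fact is introduced (definitions with bodies and theorems only).

## References

* W. J. Paul, N. Pippenger, E. Szemerédi, W. T. Trotter, *On determinism versus non-determinism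
  and related problems*, FOCS 1983, 429–438, §3 [PaulEtAl1983].
* T. Nipkow, G. Klein, *Concrete Semantics with Isabelle/HOL*, Springer 2014, Ch. 7–8 (big-step
  reasoning about structured programs) [folklore].
-/

namespace Literature.Computability.Complexity

open Function

/-- Registers of the interpreter of a `K`-register flat program: the simulated registers, four
unary statistics per register (`dn = h − min`, `mn = min`, `up = max − h`, `mx = max`), the unary
program counter and the unary fuel. [folklore] -/
inductive IReg (K : ℕ) : Type
  | r (k : Fin K)
  | dn (k : Fin K)
  | mn (k : Fin K)
  | up (k : Fin K)
  | mx (k : Fin K)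
  | pc
  | fuel
  deriving DecidableEq, Fintype

namespace PPSTInterp

open Com

variable {K : ℕ}

/-! ### Register files -/

/-- The mathematical content of the interpreter's registers. [folklore] -/
@[ext] structure ISt (K : ℕ) where
  /-- simulated registers -/
  regs : Fin K → List Bool
  /-- `h − min` -/
  d : Fin K → ℕ
  /-- running minimum -/
  m : Fin K → ℕ
  /-- `max − h` -/
  u : Fin K → ℕ
  /-- running maximum -/
  M : Fin K → ℕ
  /-- program counter -/
  pc : ℕ
  /-- fuel -/
  fuel : ℕ

/-- The register file of a state (unary fields as `ones n = 1ⁿ`, `UnaryArithMachines.lean`).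
[folklore] -/
def ISt.store (S : ISt K) : Regs (IReg K)
  | .r k => S.regs k
  | .dn k => ones (S.d k)
  | .mn k => ones (S.m k)
  | .up k => ones (S.u k)
  | .mx k => ones (S.M k)
  | .pc => ones S.pc
  | .fuel => ones S.fuel

section StoreLemmas

variable (S : ISt K) (k : Fin K)

/-- Reading a simulated register. [folklore] -/
@[simp] theorem store_r : S.store (.r k) = S.regs k := rfl
/-- Reading `dn`. [folklore] -/
@[simp] theorem store_dn : S.store (.dn k) = ones (S.d k) := rfl
/-- Reading `mn`. [folklore] -/
@[simp] theorem store_mn : S.store (.mn k) = ones (S.m k) := rfl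
/-- Reading `up`. [folklore] -/
@[simp] theorem store_up : S.store (.up k) = ones (S.u k) := rfl
/-- Reading `mx`. [folklore] -/
@[simp] theorem store_mx : S.store (.mx k) = ones (S.M k) := rfl
/-- Reading `pc`. [folklore] -/
@[simp] theorem store_pc : S.store .pc = ones S.pc := rfl
/-- Reading `fuel`. [folklore] -/
@[simp] theorem store_fuel : S.store .fuel = ones S.fuel := rfl

/-- Updating a simulated register. [folklore] -/
theorem update_r (w : List Bool) :
    update S.store (.r k) w = ({ S with regs := update S.regs k w } : ISt K).store := by
  funext i; cases i <;> simp [ISt.store, update_apply, eq_comm]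

/-- Updating `dn`. [folklore] -/
theorem update_dn (n : ℕ) :
    update S.store (.dn k) (ones n) = ({ S with d := update S.d k n } : ISt K).store := by
  funext i
  cases i <;> simp [ISt.store, update_apply, eq_comm]
  split_ifs <;> simp_all

/-- Updating `mn`. [folklore] -/
theorem update_mn (n : ℕ) :
    update S.store (.mn k) (ones n) = ({ S with m := update S.m k n } : ISt K).store := by
  funext i
  cases i <;> simp [ISt.store, update_apply, eq_comm]
  split_ifs <;> simp_all

/-- Updating `up`. [folklore] -/
theorem update_up (n : ℕ) :
    update S.store (.up k) (ones n) = ({ S with u := update S.u k n } : ISt K).store := by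
  funext i
  cases i <;> simp [ISt.store, update_apply, eq_comm]
  split_ifs <;> simp_all

/-- Updating `mx`. [folklore] -/
theorem update_mx (n : ℕ) :
    update S.store (.mx k) (ones n) = ({ S with M := update S.M k n } : ISt K).store := by
  funext i
  cases i <;> simp [ISt.store, update_apply, eq_comm]
  split_ifs <;> simp_all

/-- Updating `pc`. [folklore] -/
theorem update_pc (n : ℕ) : update S.store .pc (ones n) = ({ S with pc := n } : ISt K).store := by
  funext i; cases i <;> simp [ISt.store]

/-- Updating `fuel`. [folklore] -/
theorem update_fuel (n : ℕ) :
    update S.store .fuel (ones n) = ({ S with fuel := n } : ISt K).store := by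
  funext i; cases i <;> simp [ISt.store]

end StoreLemmas

/-! ### Height bookkeeping -/

/-- After a push on `k`: `d += 1`; `u -= 1` if positive, else `max += 1`. [folklore] -/
def incH (k : Fin K) : Com (IReg K) :=
  push (.dn k) true ;; pop (.up k) skip skip (push (.mx k) true)

/-- The state after `incH`. [folklore] -/
def incHSt (S : ISt K) (k : Fin K) : ISt K :=
  if S.u k = 0 then { S with d := update S.d k (S.d k + 1), M := update S.M k (S.M k + 1) }
  else { S with d := update S.d k (S.d k + 1), u := update S.u k (S.u k - 1) }

/-- `incH` costs at most `4`. [folklore] -/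
theorem runs_incH (S : ISt K) (k : Fin K) : Runs (incH k) S.store (incHSt S k).store 4 := by
  unfold incH incHSt
  have h1 : Runs (push (IReg.dn k) true) S.store
      ({ S with d := update S.d k (S.d k + 1) } : ISt K).store 1 :=
    Runs.push' (by rw [store_dn]; exact update_dn S k (S.d k + 1))
  set S₁ : ISt K := { S with d := update S.d k (S.d k + 1) } with hS₁
  rcases h : S.u k with _ | n
  · rw [if_pos rfl]
    refine (h1.seq (Runs.pop_nil skip skip (B := 1) (by simp [S₁, h]) (Runs.push' ?_))).of_eq rfl (by norm_num)
    exact update_mx S₁ k (S.M k + 1)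
  · rw [if_neg (by omega)]
    refine (h1.seq (Runs.pop_true skip (push (IReg.mx k) true) (w := ones n) (B := 0)
      (by simp [S₁, h, List.replicate_succ]) ((Runs.skip _).of_eq ?_ le_rfl))).of_eq rfl (by norm_num)
    rw [update_up]
    simp [S₁]

/-- After a pop on `k`: `u += 1`; `d -= 1` if positive, else `min -= 1` (if positive).
[folklore] -/
def decH (k : Fin K) : Com (IReg K) :=
  push (.up k) true ;; pop (.dn k) skip skip (pop (.mn k) skip skip skip)

/-- The state after `decH`. [folklore] -/
def decHSt (S : ISt K) (k : Fin K) : ISt K :=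
  if S.d k = 0 then { S with u := update S.u k (S.u k + 1), m := update S.m k (S.m k - 1) }
  else { S with u := update S.u k (S.u k + 1), d := update S.d k (S.d k - 1) }

/-- `decH` costs at most `5`. [folklore] -/
theorem runs_decH (S : ISt K) (k : Fin K) : Runs (decH k) S.store (decHSt S k).store 5 := by
  unfold decH decHSt
  have h1 : Runs (push (IReg.up k) true) S.store
      ({ S with u := update S.u k (S.u k + 1) } : ISt K).store 1 :=
    Runs.push' (by rw [store_up]; exact update_up S k (S.u k + 1))
  set S₁ : ISt K := { S with u := update S.u k (S.u k + 1) } with hS₁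
  rcases h : S.d k with _ | n
  · rw [if_pos rfl]
    rcases hm : S.m k with _ | n'
    · refine (h1.seq (Runs.pop_nil skip skip (B := 2) (by simp [S₁, h])
        (Runs.pop_nil skip skip (B := 0) (by simp [S₁, hm]) ((Runs.skip _).of_eq ?_ le_rfl)))).of_eq
        rfl (by norm_num)
      have : update S.m k 0 = S.m := Function.update_eq_self_iff.2 hm.symm
      simp [S₁, this]
    · refine (h1.seq (Runs.pop_nil skip skip (B := 2) (by simp [S₁, h])
        (Runs.pop_true skip skip (w := ones n') (B := 0) (by simp [S₁, hm, List.replicate_succ])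
          ((Runs.skip _).of_eq ?_ le_rfl)))).of_eq rfl (by norm_num)
      rw [update_mn]
      simp [S₁]
  · rw [if_neg (by omega)]
    refine (h1.seq (Runs.pop_true skip (pop (IReg.mn k) skip skip skip) (w := ones n) (B := 0)
      (by simp [S₁, h, List.replicate_succ]) ((Runs.skip _).of_eq ?_ le_rfl))).of_eq rfl (by norm_num)
    rw [update_dn]
    simp [S₁]

/-- `n` pushes of `true` on register `a`. [folklore] -/
def units (a : IReg K) : ℕ → Com (IReg K)
  | 0 => skip
  | n + 1 => push a true ;; units a n

/-- `units .pc n` on an empty counter writes `n`, in `n` steps. [folklore] -/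
theorem runs_units_pc (n : ℕ) : ∀ (S : ISt K), Runs (units .pc n) S.store
    ({ S with pc := S.pc + n } : ISt K).store n := by
  induction n with
  | zero => intro S; exact (Runs.skip _).of_eq rfl le_rfl
  | succ n ih =>
    intro S
    have h1 : Runs (push IReg.pc true) S.store ({ S with pc := S.pc + 1 } : ISt K).store 1 :=
      Runs.push' (by rw [store_pc]; exact update_pc S (S.pc + 1))
    refine (h1.seq (ih _)).of_eq ?_ (by omega)
    simp only [Nat.add_assoc, Nat.add_comm 1 n]

/-! ### One simulated step -/

variable (P : AProg Bool (Fin K))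

/-- **Instruction `i` of `P`** on the interpreter's registers, with height bookkeeping, followed by
writing the new (clamped) counter on the emptied counter register (a halted or out-of-range `i`
is idle and rewrites `|P|`). [folklore] -/
def exec (i : ℕ) : Com (IReg K) :=
  match P[i]? with
  | none => units .pc P.length
  | some (.push k a) => push (.r k) a ;; incH k ;; units .pc (min (i + 1) P.length)
  | some (.goto j) => units .pc (min j P.length)
  | some (.pop k j) =>
      pop (.r k) (decH k ;; units .pc (min (j (some true)) P.length))
        (decH k ;; units .pc (min (j (some false)) P.length))
        (units .pc (min (j none) P.length))

/-- The state after `exec P i`. [folklore] -/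
def execSt (S : ISt K) (i : ℕ) : ISt K :=
  match P[i]? with
  | none => { S with pc := S.pc + P.length }
  | some (.push k a) =>
      let S₁ := incHSt { S with regs := update S.regs k (a :: S.regs k) } k
      { S₁ with pc := S₁.pc + min (i + 1) P.length }
  | some (.goto j) => { S with pc := S.pc + min j P.length }
  | some (.pop k j) =>
      match S.regs k with
      | [] => { S with pc := S.pc + min (j none) P.length }
      | a :: w =>
        let S₁ := decHSt { S with regs := update S.regs k w } k
        { S₁ with pc := S₁.pc + min (j (some a)) P.length }

/-- `exec P i` costs at most `|P| + 7`. [folklore] -/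
theorem runs_exec (S : ISt K) (i : ℕ) : Runs (exec P i) S.store (execSt P S i).store (P.length + 7) := by
  unfold exec execSt
  rcases hP : P[i]? with _ | ⟨k, a⟩ | ⟨k, j⟩ | ⟨j⟩
  · exact (runs_units_pc _ S).of_eq rfl (by omega)
  · simp only
    have h1 : Runs (push (IReg.r k) a) S.store
        ({ S with regs := update S.regs k (a :: S.regs k) } : ISt K).store 1 :=
      Runs.push' (by rw [store_r, update_r])
    have h2 := runs_incH ({ S with regs := update S.regs k (a :: S.regs k) } : ISt K) k
    have h3 := runs_units_pc (min (i + 1) P.length)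
      (incHSt ({ S with regs := update S.regs k (a :: S.regs k) } : ISt K) k)
    have hle := Nat.min_le_right (i + 1) P.length
    have h := h1.seq (h2.seq h3)
    exact h.of_eq rfl (by omega)
  · simp only
    rcases hk : S.regs k with _ | ⟨a, w⟩
    · simp only
      have h3 := runs_units_pc (min (j none) P.length) S
      have hle := Nat.min_le_right (j none) P.length
      exact (Runs.pop_nil _ _ (by simp [hk]) h3).of_eq rfl (by omega)
    · simp only
      have hst : S.store (.r k) = a :: w := by simp [hk]
      have hup : update S.store (.r k) w = ({ S with regs := update S.regs k w } : ISt K).store :=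
        update_r S k w
      have h2 := runs_decH ({ S with regs := update S.regs k w } : ISt K) k
      have h3 := fun o : Option Bool => runs_units_pc (min (j o) P.length)
        (decHSt ({ S with regs := update S.regs k w } : ISt K) k)
      have hle := fun o : Option Bool => Nat.min_le_right (j o) P.length
      cases a
      · have hin := h2.seq (h3 (some false))
        rw [← hup] at hin
        exact (Runs.pop_false _ _ hst hin).of_eq rfl (by have := hle (some false); omega)
      · have hin := h2.seq (h3 (some true))
        rw [← hup] at hin
        exact (Runs.pop_true _ _ hst hin).of_eq rfl (by have := hle (some true); omega)
  · simp only
    have hle := Nat.min_le_right j P.length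
    exact (runs_units_pc _ S).of_eq rfl (by omega)

/-- **Decoding the unary counter**: having popped `i` units, pop up to `n` more; on exhaustion
execute instruction (number of units popped). [folklore] -/
def decode : ℕ → ℕ → Com (IReg K)
  | i, 0 => exec P i
  | i, n + 1 => pop .pc (decode (i + 1) n) (decode (i + 1) n) (exec P i)

/-- `decode P i n` from counter value `q ≤ n` executes instruction `i + q` on the emptied counter,
within `2 q + |P| + 9` steps. [folklore] -/
theorem runs_decode : ∀ (n i : ℕ) (S : ISt K), S.pc ≤ n →
    Runs (decode P i n) S.store (execSt P { S with pc := 0 } (i + S.pc)).store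
      (2 * S.pc + (P.length + 9)) := by
  intro n
  induction n with
  | zero =>
    intro i S hS
    have h0 : S.pc = 0 := Nat.le_zero.1 hS
    have hS' : ({ S with pc := 0 } : ISt K) = S := by
      ext <;> simp [h0]
    rw [hS', h0, Nat.add_zero]
    exact (runs_exec P S i).of_eq rfl (by omega)
  | succ n ih =>
    intro i S hS
    rcases hpc : S.pc with _ | q
    · have hS' : ({ S with pc := 0 } : ISt K) = S := by
        ext <;> simp [hpc]
      rw [hS', Nat.add_zero]
      exact (Runs.pop_nil _ _ (by simp [hpc]) (runs_exec P S i)).of_eq rfl (by omega)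
    · have hst : S.store .pc = true :: ones q := by rw [store_pc, hpc]; rfl
      have hq : ({ S with pc := q } : ISt K).pc ≤ n := by simp; omega
      have h := ih (i + 1) { S with pc := q } hq
      have h' : Runs (decode P (i + 1) n) (update S.store .pc (ones q))
          (execSt P { S with pc := 0 } (i + 1 + q)).store (2 * q + (P.length + 9)) := by
        rw [update_pc]; exact h.of_eq rfl le_rfl
      exact (Runs.pop_true _ _ hst h').of_eq (by rw [show i + 1 + q = i + (q + 1) by omega])
        (by omega)

/-- **One simulated step**: decode, execute, re-encode. [folklore] -/
def stepBody : Com (IReg K) := decode P 0 P.length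

/-- `stepBody` costs at most `3|P| + 9` from a counter `≤ |P|`. [folklore] -/
theorem runs_stepBody (S : ISt K) (hS : S.pc ≤ P.length) :
    Runs (stepBody P) S.store (execSt P { S with pc := 0 } S.pc).store (3 * P.length + 9) := by
  have h := runs_decode P P.length 0 S hS
  rw [Nat.zero_add] at h
  exact h.of_eq rfl (by omega)

/-! ### Canonical states and the simulated step -/

/-- The running minimum after a step. [folklore] -/
def newMin (c' : ACfg Bool (Fin K)) (mn : Fin K → ℕ) : Fin K → ℕ :=
  fun k => min (mn k) (c'.regs k).length

/-- The running maximum after a step. [folklore] -/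
def newMax (c' : ACfg Bool (Fin K)) (mx : Fin K → ℕ) : Fin K → ℕ :=
  fun k => max (mx k) (c'.regs k).length

/-- **The canonical interpreter state** of a simulated configuration with running extreme
heights `mn ≤ h ≤ mx` and fuel `f`. [folklore] -/
def canon (c : ACfg Bool (Fin K)) (mn mx : Fin K → ℕ) (f : ℕ) : ISt K :=
  { regs := c.regs, d := fun k => (c.regs k).length - mn k, m := mn,
    u := fun k => mx k - (c.regs k).length, M := mx, pc := min c.pc P.length, fuel := f }

/-- **`exec` performs `P.step` on canonical states**, with the running extreme heights updated.
[folklore] -/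
theorem execSt_canon (c : ACfg Bool (Fin K)) (mn mx : Fin K → ℕ) (f : ℕ)
    (hmn : ∀ k, mn k ≤ (c.regs k).length) (hmx : ∀ k, (c.regs k).length ≤ mx k) :
    execSt P { canon P c mn mx f with pc := 0 } (min c.pc P.length) =
      canon P (P.step c) (newMin (P.step c) mn) (newMax (P.step c) mx) f := by
  obtain ⟨pc, R⟩ := c
  simp only at hmn hmx
  by_cases hlt : pc < P.length
  · rw [Nat.min_eq_left hlt.le]
    unfold execSt
    rcases hP : P[pc]? with _ | ⟨k, a⟩ | ⟨k, j⟩ | ⟨j⟩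
    · exact absurd hP (by rw [List.getElem?_eq_getElem hlt]; simp)
    · -- push
      rw [AProg.step_of_getElem? P hP]
      dsimp only
      have hu : mx k - (R k).length = 0 ↔ mx k = (R k).length := by have := hmx k; omega
      unfold incHSt
      split_ifs with h0
      · simp only [canon] at h0
        rw [hu] at h0
        simp only [canon]
        ext k' <;> simp only [update_apply, newMin, newMax, Nat.zero_add] <;>
          (by_cases hk : k' = k) <;> simp [hk] <;>
          (try subst hk) <;> (try have := hmn k') <;> (try have := hmx k') <;>
          (try have := hmn k) <;> (try have := hmx k) <;> omega
      · simp only [canon] at h0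
        rw [hu] at h0
        simp only [canon]
        ext k' <;> simp only [update_apply, newMin, newMax, Nat.zero_add] <;>
          (by_cases hk : k' = k) <;> simp [hk] <;>
          (try subst hk) <;> (try have := hmn k') <;> (try have := hmx k') <;>
          (try have := hmn k) <;> (try have := hmx k) <;> omega
    · -- pop
      rw [AProg.step_of_getElem? P hP]
      dsimp only
      simp only [canon]
      rcases hR : R k with _ | ⟨a, w⟩
      · dsimp only
        ext k' <;> simp [newMin, newMax] <;> (try have := hmn k') <;> (try have := hmx k') <;> omega
      · dsimp only
        have hmnk := hmn k
        have hmxk := hmx k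
        rw [hR, List.length_cons] at hmnk hmxk
        have hd : (R k).length - mn k = 0 ↔ mn k = w.length + 1 := by
          rw [hR, List.length_cons]; omega
        unfold decHSt
        split_ifs with h0
        · simp only at h0
          rw [hd] at h0
          ext k' <;> simp only [update_apply, newMin, newMax, Nat.zero_add] <;>
            (by_cases hk : k' = k) <;> simp [hk, hR] <;>
            (try subst hk) <;> (try have := hmn k') <;> (try have := hmx k') <;>
            (try rw [hR] at *) <;> (try simp only [List.length_cons] at *) <;> omega
        · simp only at h0
          rw [hd] at h0
          ext k' <;> simp only [update_apply, newMin, newMax, Nat.zero_add] <;>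
            (by_cases hk : k' = k) <;> simp [hk, hR] <;>
            (try subst hk) <;> (try have := hmn k') <;> (try have := hmx k') <;>
            (try rw [hR] at *) <;> (try simp only [List.length_cons] at *) <;> omega
    · -- goto
      rw [AProg.step_of_getElem? P hP]
      dsimp only
      simp only [canon]
      ext k' <;> simp [newMin, newMax] <;> (try have := hmn k') <;> (try have := hmx k') <;> omega
  · rw [Nat.min_eq_right (Nat.le_of_not_lt hlt)]
    have hnone : P[P.length]? = none := List.getElem?_eq_none le_rfl
    rw [AProg.step_of_le P (Nat.le_of_not_lt hlt)]
    unfold execSt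
    rw [hnone]
    simp only [canon, Nat.zero_add, Nat.min_eq_right (Nat.le_of_not_lt hlt)]
    ext k' <;> simp [newMin, newMax] <;> (try have := hmn k') <;> (try have := hmx k') <;> omega

/-! ### The fuelled loop -/

/-- **The interpreter loop**: one simulated step per unit of fuel. [folklore] -/
def simLoop : Com (IReg K) := loop .fuel (stepBody P) (stepBody P)

/-- The running minimum after `f` simulated steps. [folklore] -/
def statMin : ℕ → ACfg Bool (Fin K) → (Fin K → ℕ) → Fin K → ℕ
  | 0, _, mn => mn
  | f + 1, c, mn => statMin f (P.step c) (newMin (P.step c) mn)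

/-- The running maximum after `f` simulated steps. [folklore] -/
def statMax : ℕ → ACfg Bool (Fin K) → (Fin K → ℕ) → Fin K → ℕ
  | 0, _, mx => mx
  | f + 1, c, mx => statMax f (P.step c) (newMax (P.step c) mx)

/-- **The interpreter loop simulates `P`**: from the canonical state of `c` with fuel `f` it
reaches the canonical state of `P.step^[f] c` with the running extreme heights and no fuel,
within `f (3|P| + 11) + 1` steps. [folklore] -/
theorem runs_simLoop : ∀ (f : ℕ) (c : ACfg Bool (Fin K)) (mn mx : Fin K → ℕ),
    (∀ k, mn k ≤ (c.regs k).length) → (∀ k, (c.regs k).length ≤ mx k) →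
    Runs (simLoop P) (canon P c mn mx f).store
      (canon P (P.step^[f] c) (statMin P f c mn) (statMax P f c mx) 0).store
      (f * (3 * P.length + 11) + 1) := by
  intro f
  induction f with
  | zero =>
    intro c mn mx _ _
    exact (Runs.loop_nil _ _ (by simp [canon])).of_eq rfl (by simp)
  | succ f ih =>
    intro c mn mx hmn hmx
    have hfuel : (canon P c mn mx (f + 1)).store .fuel = true :: ones f := rfl
    have hupd : update (canon P c mn mx (f + 1)).store .fuel (ones f) = (canon P c mn mx f).store := by
      rw [update_fuel]; rfl
    have hpc : (canon P c mn mx f).pc ≤ P.length := Nat.min_le_right _ _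
    have h1 := runs_stepBody P (canon P c mn mx f) hpc
    rw [show (canon P c mn mx f).pc = min c.pc P.length from rfl, execSt_canon P c mn mx f hmn hmx] at h1
    have hmn' : ∀ k, newMin (P.step c) mn k ≤ ((P.step c).regs k).length := fun k => Nat.min_le_right _ _
    have hmx' : ∀ k, ((P.step c).regs k).length ≤ newMax (P.step c) mx k := fun k => Nat.le_max_right _ _
    have h2 := ih (P.step c) (newMin (P.step c) mn) (newMax (P.step c) mx) hmn' hmx'
    refine (Runs.loop_true hfuel (w := ones f) (by rw [hupd]; exact h1) h2).of_eq ?_ ?_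
    · rw [Function.iterate_succ_apply]; rfl
    · have : (f + 1) * (3 * P.length + 11) = f * (3 * P.length + 11) + (3 * P.length + 11) :=
        Nat.succ_mul _ _
      omega

/-! ### The statistics are the extreme heights -/

/-- The running minimum is a lower bound of all simulated heights and is attained (or is the
initial value). [folklore] -/
theorem statMin_spec : ∀ (f : ℕ) (c : ACfg Bool (Fin K)) (mn : Fin K → ℕ) (k : Fin K),
    (∀ k, mn k ≤ (c.regs k).length) →
    (∀ t, t ≤ f → statMin P f c mn k ≤ ((P.step^[t] c).regs k).length) ∧
      statMin P f c mn k ≤ mn k ∧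
      (statMin P f c mn k = mn k ∨ ∃ t, t ≤ f ∧ statMin P f c mn k = ((P.step^[t] c).regs k).length) := by
  intro f
  induction f with
  | zero =>
    intro c mn k hmn
    refine ⟨fun t ht => ?_, le_rfl, Or.inl rfl⟩
    rw [Nat.le_zero.1 ht]; exact hmn k
  | succ f ih =>
    intro c mn k hmn
    have hmn' : ∀ k, newMin (P.step c) mn k ≤ ((P.step c).regs k).length :=
      fun k => Nat.min_le_right _ _
    obtain ⟨h1, h2, h3⟩ := ih (P.step c) (newMin (P.step c) mn) k hmn'
    simp only [statMin]
    refine ⟨fun t ht => ?_, h2.trans (Nat.min_le_left _ _), ?_⟩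
    · rcases Nat.eq_zero_or_pos t with rfl | hpos
      · exact (h2.trans (Nat.min_le_left _ _)).trans (hmn k)
      · obtain ⟨t', rfl⟩ : ∃ t', t = t' + 1 := ⟨t - 1, by omega⟩
        rw [Function.iterate_succ_apply]
        exact h1 t' (by omega)
    · rcases h3 with h3 | ⟨t, ht, h3⟩
      · rcases Nat.le_total (mn k) (((P.step c).regs k).length) with hle | hle
        · left; rw [h3]; exact Nat.min_eq_left hle
        · right; refine ⟨1, by omega, ?_⟩
          rw [h3, Function.iterate_one]; exact Nat.min_eq_right hle
      · right; refine ⟨t + 1, by omega, ?_⟩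
        rw [h3, Function.iterate_succ_apply]

/-- The running maximum is an upper bound of all simulated heights and is attained (or is the
initial value). [folklore] -/
theorem statMax_spec : ∀ (f : ℕ) (c : ACfg Bool (Fin K)) (mx : Fin K → ℕ) (k : Fin K),
    (∀ k, (c.regs k).length ≤ mx k) →
    (∀ t, t ≤ f → ((P.step^[t] c).regs k).length ≤ statMax P f c mx k) ∧
      mx k ≤ statMax P f c mx k ∧
      (statMax P f c mx k = mx k ∨ ∃ t, t ≤ f ∧ statMax P f c mx k = ((P.step^[t] c).regs k).length) := by
  intro f
  induction f with
  | zero =>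
    intro c mx k hmx
    refine ⟨fun t ht => ?_, le_rfl, Or.inl rfl⟩
    rw [Nat.le_zero.1 ht]; exact hmx k
  | succ f ih =>
    intro c mx k hmx
    have hmx' : ∀ k, ((P.step c).regs k).length ≤ newMax (P.step c) mx k :=
      fun k => Nat.le_max_right _ _
    obtain ⟨h1, h2, h3⟩ := ih (P.step c) (newMax (P.step c) mx) k hmx'
    simp only [statMax]
    refine ⟨fun t ht => ?_, (Nat.le_max_left _ _).trans h2, ?_⟩
    · rcases Nat.eq_zero_or_pos t with rfl | hpos
      · exact (hmx k).trans ((Nat.le_max_left _ _).trans h2)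
      · obtain ⟨t', rfl⟩ : ∃ t', t = t' + 1 := ⟨t - 1, by omega⟩
        rw [Function.iterate_succ_apply]
        exact h1 t' (by omega)
    · rcases h3 with h3 | ⟨t, ht, h3⟩
      · rcases Nat.le_total (((P.step c).regs k).length) (mx k) with hle | hle
        · left; rw [h3]; exact Nat.max_eq_left hle
        · right; refine ⟨1, by omega, ?_⟩
          rw [h3, Function.iterate_one]; exact Nat.max_eq_right hle
      · right; refine ⟨t + 1, by omega, ?_⟩
        rw [h3, Function.iterate_succ_apply]

end PPSTInterp

end Literature.Computability.Complexity
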